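import Literature.Probability.RandomPlanarGeometry.LoewnerInverse
import HarnessLib

/-!
# Brownian-type scaling of the Loewner maps and of the inverse maps `fₜ`

Trunk T-STOCH support. For the chordal Loewner chain driven by a continuous `W : ℝ≥0 → ℝ`
and `c > 0`, let `S_c W := (s ↦ c W(s / c²))` be the rescaled driving function (the form used in
`Literature/Probability/RandomPlanarGeometry/LoewnerChain.lean`, `Loewner.IsSolution.scale`,
`Loewner.swallowingTime_scale`, `Loewner.hull_scale_holds`). We prove the scaling rules

* `map_scale`:        `g^{S_c W}_t (c z) = c g^W_{t/c²}(z)`     (`z ∈ H_{t/c²}`),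
* `loewnerInv_scale`: `f^{S_c W}_t (c w) = c f^W_{t/c²}(w)`     (`w ∈ ℍₒ`),
* `deriv_loewnerInv_scale`: `(f^{S_c W}_t)' (c w) = (f^W_{t/c²})'(w)` (`w ∈ ℍₒ`),

the deterministic half of the scale invariance of the derivative estimates for SLE
(Rohde–Schramm (2005), proof of Cor. 3.5 and of Thm. 3.6: "By scale invariance").
Lawler, *Conformally Invariant Processes in the Plane* (2005), Ch. 4 §4.1 (scaling rule
`g_t(z) = r⁻¹ g*_{r² t}(r z)`), Prop. 3.30 / proof of Prop. 6.5.

## References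

* G. F. Lawler, *Conformally Invariant Processes in the Plane*, AMS (2005), Ch. 4 §4.1.
* S. Rohde, O. Schramm, *Basic properties of SLE*, Ann. of Math. 161 (2005), Prop. 2.1, §3.
-/

noncomputable section

open Set Filter Topology Complex
open UpperHalfPlane (upperHalfPlaneSet isOpen_upperHalfPlaneSet)
open scoped NNReal

namespace Literature.Probability.RandomPlanarGeometry

namespace Loewner

variable {W : ℝ≥0 → ℝ} {c : ℝ≥0}

/-- The rescaled driving function `s ↦ c W(s / c²)` is continuous if `W` is. [folklore] -/
theorem continuous_scaleDriving (hW : Continuous W) (c : ℝ≥0) :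
    Continuous fun s : ℝ≥0 ↦ (c : ℝ) * W (s / c ^ 2) :=
  continuous_const.mul (hW.comp (continuous_id.div_const _))

/-- **Scaling of the Loewner domains**: `c z ∈ H^{S_c W}_t ↔ z ∈ H^W_{t/c²}` (`c > 0`), from
`swallowingTime_scale`. Lawler (2005), Ch. 4 §4.1. [cite: Lawler2005, Ch. 4 §4.1] -/
theorem mul_mem_domain_scale_iff (hc : c ≠ 0) (t : ℝ≥0) (z : ℂ) :
    ((c : ℝ) : ℂ) * z ∈ domain (fun s ↦ (c : ℝ) * W (s / c ^ 2)) t ↔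
      z ∈ domain W (t / c ^ 2) := by
  have hc' : (0 : ℝ) < c := NNReal.coe_pos.2 (pos_iff_ne_zero.2 hc)
  rw [mem_domain_iff, mem_domain_iff, swallowingTime_scale hc,
    ← coe_div_lt_iff_lt_mul (pow_ne_zero 2 hc)]
  refine and_congr ?_ Iff.rfl
  change 0 < (((c : ℝ) : ℂ) * z).im ↔ 0 < z.im
  rw [Complex.im_ofReal_mul]
  exact ⟨fun h ↦ pos_of_mul_pos_right h hc'.le, fun h ↦ mul_pos hc' h⟩

/-- **Scaling of the Loewner maps**: `g^{S_c W}_t (c z) = c g^W_{t/c²}(z)` for `z ∈ H^W_{t/c²}`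
(`c > 0`): the rescaled maximal solution `u ↦ c g(u/c²)` from `c z` is a solution for `S_c W`
alive at `t` (`IsSolution.scale`), and the Loewner map evaluates solutions
(`map_eq_of_isSolution`). Lawler (2005), Ch. 4 §4.1 (scaling rule).
[cite: Lawler2005, Ch. 4 §4.1] -/
theorem map_scale (hW : Continuous W) (hc : c ≠ 0) {t : ℝ≥0} {z : ℂ}
    (hz : z ∈ domain W (t / c ^ 2)) :
    map (fun s ↦ (c : ℝ) * W (s / c ^ 2)) t (((c : ℝ) : ℂ) * z) =
      ((c : ℝ) : ℂ) * map W (t / c ^ 2) z := by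
  rw [mem_domain_iff] at hz
  obtain ⟨g, hg⟩ :=
    exists_isSolution_swallowingTime_holds hW (ne_driving_of_lt_swallowingTime hz.2)
  have h1 : map W (t / c ^ 2) z = g ((t / c ^ 2 : ℝ≥0) : ℝ) := map_eq_of_isSolution hW hg hz.2
  have hgs := hg.scale hc
  have ht : (t : WithTop ℝ≥0) < ((c ^ 2 : ℝ≥0) : WithTop ℝ≥0) * swallowingTime W z :=
    (coe_div_lt_iff_lt_mul (pow_ne_zero 2 hc) t _).1 hz.2
  have h2 := map_eq_of_isSolution (continuous_scaleDriving hW c) hgs ht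
  rw [h2, h1]
  push_cast
  rfl

/-- **Scaling of the inverse Loewner maps**: `f^{S_c W}_t (c w) = c f^W_{t/c²}(w)` for
`w ∈ ℍₒ` (`c > 0`): both sides lie in `H^{S_c W}_t` and are mapped to `c w` by the injective
map `g^{S_c W}_t` (`map_scale`). Rohde–Schramm (2005), §3 ("by scale invariance").
[cite: Lawler2005, Ch. 4 §4.1] -/
theorem loewnerInv_scale (hW : Continuous W) (hc : c ≠ 0) (t : ℝ≥0) {w : ℂ}
    (hw : 0 < w.im) :
    loewnerInv (fun s ↦ (c : ℝ) * W (s / c ^ 2)) t (((c : ℝ) : ℂ) * w) =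
      ((c : ℝ) : ℂ) * loewnerInv W (t / c ^ 2) w := by
  have hc' : (0 : ℝ) < c := NNReal.coe_pos.2 (pos_iff_ne_zero.2 hc)
  have hWc := continuous_scaleDriving hW c
  have hcw : 0 < ((((c : ℝ) : ℂ) * w)).im := by rw [Complex.im_ofReal_mul]; exact mul_pos hc' hw
  refine injOn_map hWc t (loewnerInv_mem_domain hWc t hcw) ?_ ?_
  · exact (mul_mem_domain_scale_iff hc t _).2 (loewnerInv_mem_domain hW _ hw)
  · rw [map_loewnerInv hWc t hcw, map_scale hW hc (loewnerInv_mem_domain hW _ hw),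
      map_loewnerInv hW _ hw]

/-- `fₜ` is complex differentiable at every point of `ℍₒ`, with derivative `deriv fₜ`
(`LoewnerFlow.hasDerivAt_invFunOn_map`). Lawler (2005), Thm. 4.6. [cite: Lawler2005, Thm. 4.6] -/
theorem hasDerivAt_loewnerInv (hW : Continuous W) (t : ℝ≥0) {w : ℂ} (hw : 0 < w.im) :
    HasDerivAt (loewnerInv W t) (deriv (loewnerInv W t) w) w := by
  obtain ⟨f', -, hf'⟩ := hasDerivAt_invFunOn_map hW t hw
  exact hf'.differentiableAt.hasDerivAt

/-- The derivative of `fₜ` does not vanish on `ℍₒ`. Lawler (2005), Thm. 4.6 / eq. (4.7).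
[cite: Lawler2005, Thm. 4.6] -/
theorem deriv_loewnerInv_ne_zero (hW : Continuous W) (t : ℝ≥0) {w : ℂ} (hw : 0 < w.im) :
    deriv (loewnerInv W t) w ≠ 0 := by
  obtain ⟨f', hf'0, hf'⟩ := hasDerivAt_invFunOn_map hW t hw
  rwa [hf'.deriv]

/-- **Scale invariance of the derivative of the inverse maps**:
`(f^{S_c W}_t)'(c w) = (f^W_{t/c²})'(w)` for `w ∈ ℍₒ` (`c > 0`): near `c w` one has
`f^{S_c W}_t = (v ↦ c f^W_{t/c²}(v / c))` (`loewnerInv_scale` on the open set `ℍₒ`), and the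
chain rule. Rohde–Schramm (2005), proof of Cor. 3.5 ("By scale invariance").
[cite: RohdeSchramm2005, Cor. 3.5 (proof)] -/
theorem deriv_loewnerInv_scale (hW : Continuous W) (hc : c ≠ 0) (t : ℝ≥0) {w : ℂ}
    (hw : 0 < w.im) :
    deriv (loewnerInv (fun s ↦ (c : ℝ) * W (s / c ^ 2)) t) (((c : ℝ) : ℂ) * w) =
      deriv (loewnerInv W (t / c ^ 2)) w := by
  have hc' : (0 : ℝ) < c := NNReal.coe_pos.2 (pos_iff_ne_zero.2 hc)
  have hcc : ((c : ℝ) : ℂ) ≠ 0 := by exact_mod_cast hc'.ne'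
  have hcw : 0 < ((((c : ℝ) : ℂ) * w)).im := by rw [Complex.im_ofReal_mul]; exact mul_pos hc' hw
  -- local representation near `c w`
  have hev : loewnerInv (fun s ↦ (c : ℝ) * W (s / c ^ 2)) t =ᶠ[𝓝 (((c : ℝ) : ℂ) * w)]
      fun v ↦ ((c : ℝ) : ℂ) * loewnerInv W (t / c ^ 2) (v / ((c : ℝ) : ℂ)) := by
    filter_upwards [isOpen_upperHalfPlaneSet.mem_nhds hcw] with v hv
    have hv' : 0 < (v / ((c : ℝ) : ℂ)).im := by
      rw [div_eq_mul_inv, ← Complex.ofReal_inv, mul_comm, Complex.im_ofReal_mul]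
      exact mul_pos (inv_pos.2 hc') hv
    have := loewnerInv_scale hW hc t hv'
    rwa [mul_div_cancel₀ _ hcc] at this
  rw [hev.deriv_eq]
  -- chain rule for `v ↦ c f(v / c)` at `c w`
  have hdiv : HasDerivAt (fun v : ℂ ↦ v / ((c : ℝ) : ℂ)) (((c : ℝ) : ℂ))⁻¹
      (((c : ℝ) : ℂ) * w) := by
    simpa [div_eq_mul_inv] using
      (hasDerivAt_id (((c : ℝ) : ℂ) * w)).mul_const (((c : ℝ) : ℂ))⁻¹
  have hw' : ((c : ℝ) : ℂ) * w / ((c : ℝ) : ℂ) = w := mul_div_cancel_left₀ w hcc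
  have hf : HasDerivAt (loewnerInv W (t / c ^ 2)) (deriv (loewnerInv W (t / c ^ 2)) w)
      (((c : ℝ) : ℂ) * w / ((c : ℝ) : ℂ)) := by
    rw [hw']; exact hasDerivAt_loewnerInv hW _ hw
  have hcomp : HasDerivAt
      (fun v ↦ ((c : ℝ) : ℂ) * loewnerInv W (t / c ^ 2) (v / ((c : ℝ) : ℂ)))
      (((c : ℝ) : ℂ) * (deriv (loewnerInv W (t / c ^ 2)) w * (((c : ℝ) : ℂ))⁻¹))
      (((c : ℝ) : ℂ) * w) :=
    ((hf.comp (((c : ℝ) : ℂ) * w) hdiv).const_mul (((c : ℝ) : ℂ))).congr_of_eventuallyEq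
      (Eventually.of_forall fun _ ↦ rfl)
  rw [hcomp.deriv]
  field_simp

end Loewner

end Literature.Probability.RandomPlanarGeometry
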